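/-
Copyright (c) 2026. All rights reserved.
Released under Apache 2.0 license as described in the file LICENSE.
Authors: abc-iut cell, prover seat abc-iut-L4-t15 (gen 10).
-/
import Literature.IUT.HodgeTheaters.PuncturedEllipticGeomOriginIota
import Literature.IUT.HodgeTheaters.PuncturedEllipticGeomOriginInvolutionProfiniteModel
import HarnessLib

/-!
# [IUTchI] §1: abc-iut-L5-t1's record `GeomOriginIota` (geometric origin WITH the elliptic involution) is
# INHABITED at the profinite datum `D₀` — one constructor over `exists_geomOrigin_involution`

Mochizuki, *Inter-universal Teichmüller theory I*, §1 p. 37 (`C = X/{±1}`) [cite: Mochizuki2012, IUTchI §1 p.37]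
(D-0012 claim key; nothing of the disputed series is asserted); [EtTh] Def. 2.1 p. 33 (`Δ_C = Δ_X ⋊ ⟨ι⟩`).
PROOF-ONLY (0 definitions, 0 named facts; cell abc-iut, seat abc-iut-L4-t15 gen 10; L5 rows R46/R47): the record
`PuncturedEllipticData.GeomOriginIota` (abc-iut-L5-t1, p501139: `GeomOrigin` + `iota ∈ Δ_C`, `iota ∉ Π_X`,
`iota² = 1`, `iota·gensᵢ·iota⁻¹ = gensᵢ⁻¹`) — a HYPOTHESIS record asserted for no datum — has the inhabitant
`⟨O, η(σ), …⟩` at the datum `D₀` of `PuncturedEllipticGeomOriginProfiniteModel.lean` (`Π_C = Ŵ`,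
`W = F₂ ⋊[φ] ℤ/2`, `G_k = Gal(ℚ̄/ℚ̄)`), all four ι-clauses being `PuncturedEllipticData.exists_geomOrigin_involution`
(p501711).  Consequently L5-t1's §2 consequences (`iota_conj_mem_deltaX`, `mul_iota_mem_deltaX`,
`iota_conj_mul_mem_closure_commutator`: "`ι = −1` on `Δ_X^{ab}`") hold at SOME datum — stated as a non-vacuity
corollary.  HONEST LABEL: group-theoretic model, not an étale `π₁`; NV evidence for the record type only;
nothing here bears on [IUTchIII] Cor. 3.12; inhabited ≠ endorsed; no side taken.
-/

noncomputable section

namespace Literature.IUT.HodgeTheaters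

namespace PuncturedEllipticData

/-- **`GeomOriginIota` is inhabited at the profinite datum `D₀`**, together with cusp rationality (r), a trivial
`G_k`, and `[Π_C : Π_X] = 2`. [cite: Mochizuki2012, IUTchI §1 p.37] -/
theorem exists_nonempty_geomOriginIota :
    ∃ D : PuncturedEllipticData.{0}, Nonempty D.GeomOriginIota ∧
      (∀ x : D.Cusp, Function.Surjective (D.E.aug.toMonoidHom.comp (D.decomp x).subtype)) ∧
      Subsingleton D.E.gal ∧ D.PiX.index = 2 := by
  obtain ⟨D, O, ι, h1, h2, h3, h4, hr, hs, hi, -⟩ := PuncturedEllipticData.exists_geomOrigin_involution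
  exact ⟨D, ⟨⟨O, ι, h1, h2, h3, h4⟩⟩, hr, hs, hi⟩

/-- **Non-vacuity of "`ι = −1` on `Δ_X^{ab}`"**: at some datum with a `GeomOriginIota` record `O`, for every
`x ∈ Δ_X` the element `ι·x·ι⁻¹·x` lies in the closure of `⁅Δ_X, Δ_X⁆` (abc-iut-L5-t1's
`GeomOriginIota.iota_conj_mul_mem_closure_commutator`, instantiated). [cite: Mochizuki2012, IUTchI §1 p.37] -/
theorem exists_geomOriginIota_iota_inverts_abelianization :
    ∃ (D : PuncturedEllipticData.{0}) (O : D.GeomOriginIota),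
      ∀ x : D.PiC, x ∈ D.PiX ⊓ D.DeltaC →
        O.iota * x * O.iota⁻¹ * x ∈ (⁅D.PiX ⊓ D.DeltaC, D.PiX ⊓ D.DeltaC⁆).topologicalClosure := by
  obtain ⟨D, ⟨O⟩, -⟩ := exists_nonempty_geomOriginIota
  exact ⟨D, O, fun x hx => O.iota_conj_mul_mem_closure_commutator hx⟩

end PuncturedEllipticData

end Literature.IUT.HodgeTheaters

end
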